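import Literature.Geometry.Lorentzian.MultiCentreRadiationZone
import Literature.Geometry.Lorentzian.HypersurfaceRestriction

/-!
# Relabelling covariance of late charts over boosted Kerr–Schild backgrounds
# (`GapDecaySuffices`, crux stmt-FinalStateConjecture-18060 — negative side, support of
# `PosCoreFalseOfLabelSwapWitness.lean`)

Refuter seat `refuter-cdisprove-stmt-FinalStateConjecture-18060-0`, 2026-08-17.  Sorry-free, standard axioms.
The witness `LabelSwapWitness` of `PosCoreFalseOfLabelSwapWitness.lean` is a label-PERMUTED honest input: every
hole chart `Ψ` of label `(Λ, c)` is replaced by `Ψ ∘ P` with the label `(L⁻¹Λ, L⁻¹(c − p))`, for one model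
Poincaré map `P x = L x + p`, `L ∈ lorentzGroup`.  Its docstring claims that the ANTECEDENT of the crux
(`FinalStateDecomposition` fields, `Hc`, `Hf`, DV) is covariant under this operation.  The set-theoretic
clauses are covariant because rest-frame time and radius transform by precomposition with `P`
(`time_relabel`, `radius_relabel`: every `(tᵢ, rᵢ)`-defined model set of the new label is the `P`-preimage of
the old one, and its image under `Ψ ∘ P` is the old image).  This file kernel-checks the ANALYTIC part of
the claim, the only one where jets and thresholds enter:

* `pre` — the model map between the two background domains (`mem_boostedKerrExterior_relabel`), smooth,
  with differential `L` (`mfderiv_pre`);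
* `deviation_comp_pre`, `deviationExtend_comp_pre(_eq)` — the deviation of `Ψ ∘ P` from the relabelled
  background is the `(L × L)`-pullback (`pullL`) of the deviation of `Ψ` from the old one, after `P`
  (chain rule on the open submanifolds + `bilin_relabel`, the Lorentz covariance of the Kerr–Schild form);
* `norm_iteratedFDeriv_deviationExtend_comp_pre_le` — `‖Dᵐ dev'(y)‖ ≤ ‖L‖² ‖L‖ᵐ ‖Dᵐ dev(P y)‖` for ALL
  `y : E4` and all orders (compositions with continuous linear EQUIVALENCES and a translation need no
  differentiability); `supCkENorm_deviationExtend_comp_pre_le` — `Cᵏ` sup norms over any `S ⊆ E4`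
  compare with the constant `jetConst L k = ‖L‖² max(1,‖L‖)ᵏ` against `P '' S`;
* consequences: `tendsto_truncDeviationCk_comp_pre` (near-zone `Cᵏ` convergence of the structure field
  `tendsto_truncDeviationCk` transfers to the relabelled chart: `P` maps new truncated slabs into old
  ones, `affP_image_truncTimeSlab_subset`), `supCkENorm_zero_comp_pre_le` (`C⁰` bounds such as `Hf`(3)
  transfer with the factor `‖L‖²` over `P`-corresponding sets — whence the slack `1/(10‖L‖⁴‖Λ‖²)` asked
  of the honest input in the witness docstring).

References: O'Neill 1983 Ch. 3 (Def. 3.9, Lemma 3.35), Ch. 9; Kerr–Schild 1965; DHRT arXiv:2104.08222 §1.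
-/

noncomputable section

open scoped Manifold ContDiff Topology ENNReal
open Filter Set Topology TopologicalSpace Literature.Geometry.Lorentzian

namespace Summit.FinalStateConjecture.FinalStateConjecture.Theorems.GapDecaySuffices.Negative.Relabel

set_option linter.dupNamespace false
set_option maxSynthPendingDepth 3

variable (Λ L : lorentzGroup) (c p : E4) (M a : ℝ)

/-- The affine model map `P x = L x + p` (O'Neill 1983, Ch. 9, p. 236). [cite: ONeill1983, Ch. 9  p. 236] -/
def affP (x : E4) : E4 := (L : E4 ≃L[ℝ] E4) x + p

/-- `P` is smooth. [folklore] -/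
theorem contDiff_affP {n : WithTop ℕ∞} : ContDiff ℝ n (affP L p) :=
  ((L : E4 ≃L[ℝ] E4) : E4 →L[ℝ] E4).contDiff.add contDiff_const

/-- `dP = L`. [folklore] -/
theorem hasFDerivAt_affP (x : E4) :
    HasFDerivAt (affP L p) ((L : E4 ≃L[ℝ] E4) : E4 →L[ℝ] E4) x := by
  unfold affP
  exact (((L : E4 ≃L[ℝ] E4) : E4 →L[ℝ] E4).hasFDerivAt (x := x)).add_const p

/-- Rest-frame coordinates of the relabelled motion are the old ones after `P` (O'Neill 1983, Ch. 9,
p. 236). [cite: ONeill1983, Ch. 9  p. 236] -/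
theorem poincareInv_relabel (x : E4) :
    poincareInv (L⁻¹ * Λ) ((L : E4 ≃L[ℝ] E4).symm (c - p)) x = poincareInv Λ c (affP L p x) := by
  simp only [poincareInv, affP]
  have h1 : ∀ u : E4, (((L⁻¹ * Λ : lorentzGroup) : E4 ≃L[ℝ] E4).symm) u =
      (Λ : E4 ≃L[ℝ] E4).symm ((L : E4 ≃L[ℝ] E4) u) := fun u ↦ rfl
  have h2 : (L : E4 ≃L[ℝ] E4) ((L : E4 ≃L[ℝ] E4).symm (c - p)) = c - p :=
    (L : E4 ≃L[ℝ] E4).apply_symm_apply (c - p)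
  rw [h1, map_sub, h2]
  congr 1
  abel

/-- The relabelled exterior domain is the `P`-preimage of the old one. [folklore] -/
theorem mem_boostedKerrExterior_relabel (x : E4) :
    x ∈ boostedKerrExterior (L⁻¹ * Λ) ((L : E4 ≃L[ℝ] E4).symm (c - p)) M a ↔
      affP L p x ∈ boostedKerrExterior Λ c M a := by
  simp only [mem_boostedKerrExterior, poincareInv_relabel]

/-- The old background `(Λ, c)` (DHRT arXiv:2104.08222, §1). [cite: arXiv210408222, §1] -/
abbrev Bold : ModelBackground := boostedKerrBackground Λ c M a
/-- The relabelled background `(L⁻¹Λ, L⁻¹(c − p))`. [cite: arXiv210408222, §1] -/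
abbrev Bnew : ModelBackground := boostedKerrBackground (L⁻¹ * Λ) ((L : E4 ≃L[ℝ] E4).symm (c - p)) M a

/-- Rest-frame time transforms by precomposition with `P`. [folklore] -/
theorem time_relabel (x : E4) : (Bnew Λ L c p M a).time x = (Bold Λ c M a).time (affP L p x) := by
  simp only [boostedKerrBackground, poincareInv_relabel]

/-- Rest-frame Kerr–Schild radius transforms by precomposition with `P`. [folklore] -/
theorem radius_relabel (x : E4) : (Bnew Λ L c p M a).radius x = (Bold Λ c M a).radius (affP L p x) := by
  simp only [boostedKerrBackground, poincareInv_relabel]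

/-- The reference form transforms by `(L × L)`-pullback after `P` (Kerr–Schild 1965, Lorentz covariance
of the ansatz). [cite: KerrSchild1965, (Lorentz covariance of the Kerr–Schild a] -/
theorem bilin_relabel (x v w : E4) :
    (Bnew Λ L c p M a).bilin x v w =
      (Bold Λ c M a).bilin (affP L p x) ((L : E4 ≃L[ℝ] E4) v) ((L : E4 ≃L[ℝ] E4) w) := by
  show boostedKerrBilin _ _ M a x v w = boostedKerrBilin Λ c M a _ _ _
  rw [boostedKerrBilin_apply, boostedKerrBilin_apply, poincareInv_relabel]
  have h1 : ∀ u : E4, (((L⁻¹ * Λ : lorentzGroup) : E4 ≃L[ℝ] E4).symm) u =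
      (Λ : E4 ≃L[ℝ] E4).symm ((L : E4 ≃L[ℝ] E4) u) := fun u ↦ rfl
  rw [h1, h1]

/-- The model map between the two background domains (`P` restricted and corestricted). [folklore] -/
def pre (x : (Bnew Λ L c p M a).domain) : (Bold Λ c M a).domain :=
  ⟨affP L p x.1, (mem_boostedKerrExterior_relabel Λ L c p M a x.1).1 x.2⟩

/-- Underlying point of `pre x` is `P x`. [folklore] -/
@[simp] theorem pre_coe (x : (Bnew Λ L c p M a).domain) : (pre Λ L c p M a x : E4) = affP L p x.1 := rfl

/-- The model map is smooth between the open submanifolds (Lee 2013, Prop. 3.9). [folklore] -/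
theorem contMDiff_pre : ContMDiff 𝓘(ℝ, E4) 𝓘(ℝ, E4) ∞ (pre Λ L c p M a) := by
  intro x
  rw [← ContMDiffAt.subtypeVal_comp_iff]
  have : (Subtype.val ∘ pre Λ L c p M a) = fun y : (Bnew Λ L c p M a).domain ↦ affP L p y.1 := rfl
  rw [this]
  exact contMDiffAt_subtype_iff.mpr (contDiff_affP L p).contMDiff.contMDiffAt

/-- The model map is differentiable. [folklore] -/
theorem mdifferentiableAt_pre (x : (Bnew Λ L c p M a).domain) :
    MDifferentiableAt 𝓘(ℝ, E4) 𝓘(ℝ, E4) (pre Λ L c p M a) x :=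
  (contMDiff_pre Λ L c p M a x).mdifferentiableAt (by simp)

/-- The differential of the model map is `L` (pointwise; `d(val) = id` on both sides, Lee 2013,
Prop. 3.9). [folklore] -/
theorem mfderiv_pre_apply (x : (Bnew Λ L c p M a).domain) (v : E4) :
    mfderiv 𝓘(ℝ, E4) 𝓘(ℝ, E4) (pre Λ L c p M a) x v = (L : E4 ≃L[ℝ] E4) v := by
  -- `val ∘ pre = affP ∘ val`; differentials of the two `val`s are identities
  have h := mfderiv_comp x
    (hasMFDerivAt_subtypeVal (I' := 𝓘(ℝ, E4)) (W := (Bold Λ c M a).domain)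
      (pre Λ L c p M a x)).mdifferentiableAt
    (mdifferentiableAt_pre Λ L c p M a x)
  have key : mfderiv 𝓘(ℝ, E4) 𝓘(ℝ, E4) (pre Λ L c p M a) x v =
      mfderiv 𝓘(ℝ, E4) 𝓘(ℝ, E4) (Subtype.val ∘ pre Λ L c p M a) x v := by
    rw [h]
    change _ = mfderiv 𝓘(ℝ, E4) 𝓘(ℝ, E4) (Subtype.val : (Bold Λ c M a).domain → E4)
      (pre Λ L c p M a x) (mfderiv 𝓘(ℝ, E4) 𝓘(ℝ, E4) (pre Λ L c p M a) x v)
    rw [mfderiv_subtypeVal]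
    rfl
  have h2 : (Subtype.val ∘ pre Λ L c p M a) =
      (affP L p) ∘ (Subtype.val : (Bnew Λ L c p M a).domain → E4) := rfl
  rw [key, h2, mfderiv_comp x ((contDiff_affP L p (n := ∞)).contMDiff.contMDiffAt.mdifferentiableAt (by simp))
    (hasMFDerivAt_subtypeVal (I' := 𝓘(ℝ, E4)) x).mdifferentiableAt]
  change mfderiv 𝓘(ℝ, E4) 𝓘(ℝ, E4) (affP L p) x.1
    (mfderiv 𝓘(ℝ, E4) 𝓘(ℝ, E4) (Subtype.val : (Bnew Λ L c p M a).domain → E4) x v) = _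
  rw [mfderiv_subtypeVal]
  change mfderiv 𝓘(ℝ, E4) 𝓘(ℝ, E4) (affP L p) x.1 v = _
  rw [mfderiv_eq_fderiv, (hasFDerivAt_affP L p x.1).fderiv]
  rfl

/-- The differential of the model map is `L`. [folklore] -/
theorem mfderiv_pre (x : (Bnew Λ L c p M a).domain) :
    mfderiv 𝓘(ℝ, E4) 𝓘(ℝ, E4) (pre Λ L c p M a) x = ((L : E4 ≃L[ℝ] E4) : E4 →L[ℝ] E4) :=
  ContinuousLinearMap.ext (mfderiv_pre_apply Λ L c p M a x)


/-! ### Charts precomposed with the model map: differential, pullback, deviation -/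

section Chart

variable {𝓢 : Spacetime.{0} 4} (Ψ : (Bold Λ c M a).domain → 𝓢.carrier)

/-- `(L × L)`-pullback of bilinear forms: `pullL L β v w = β (L v) (L w)`, as a continuous linear
automorphism of `E4 →L[ℝ] E4 →L[ℝ] ℝ` (O'Neill 1983, Ch. 3, Def. 3.9). [cite: ONeill1983, Ch. 3  Def. 3.9] -/
def pullL : (E4 →L[ℝ] E4 →L[ℝ] ℝ) ≃L[ℝ] (E4 →L[ℝ] E4 →L[ℝ] ℝ) :=
  (L : E4 ≃L[ℝ] E4).symm.arrowCongr
    ((L : E4 ≃L[ℝ] E4).symm.arrowCongr (ContinuousLinearEquiv.refl ℝ ℝ))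

/-- `pullL L β v w = β (L v) (L w)`. [folklore] -/
@[simp] theorem pullL_apply (β : E4 →L[ℝ] E4 →L[ℝ] ℝ) (v w : E4) :
    pullL L β v w = β ((L : E4 ≃L[ℝ] E4) v) ((L : E4 ≃L[ℝ] E4) w) := by
  simp [pullL]

/-- `pullL L 0 = 0`. [folklore] -/
theorem pullL_zero : pullL L 0 = 0 := map_zero _

variable {Λ L c p M a}

/-- Chain rule: `d(Ψ ∘ P)_x v = dΨ_{P x} (L v)` (O'Neill 1983, Ch. 1). [folklore] -/
theorem mfderiv_comp_pre_apply (hΨ : ContMDiff 𝓘(ℝ, E4) (𝓡 4) ∞ Ψ)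
    (x : (Bnew Λ L c p M a).domain) (v : E4) :
    mfderiv 𝓘(ℝ, E4) (𝓡 4) (Ψ ∘ pre Λ L c p M a) x v =
      mfderiv 𝓘(ℝ, E4) (𝓡 4) Ψ (pre Λ L c p M a x) ((L : E4 ≃L[ℝ] E4) v) := by
  rw [mfderiv_comp x ((hΨ _).mdifferentiableAt (by simp)) (mdifferentiableAt_pre Λ L c p M a x)]
  change mfderiv 𝓘(ℝ, E4) (𝓡 4) Ψ (pre Λ L c p M a x)
    (mfderiv 𝓘(ℝ, E4) 𝓘(ℝ, E4) (pre Λ L c p M a) x v) = _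
  rw [mfderiv_pre_apply]

/-- **Deviation covariance on the domain**: the deviation of `Ψ ∘ P` from the relabelled
background at `x` is the `(L × L)`-pullback of the deviation of `Ψ` from the old one at `P x`
(O'Neill 1983, Ch. 3, Def. 3.9; DHRT arXiv:2104.08222, §1). [cite: arXiv210408222, §1] -/
theorem deviation_comp_pre (hΨ : ContMDiff 𝓘(ℝ, E4) (𝓡 4) ∞ Ψ) (x : (Bnew Λ L c p M a).domain) :
    𝓢.deviation (Bnew Λ L c p M a) (Ψ ∘ pre Λ L c p M a) x =
      pullL L (𝓢.deviation (Bold Λ c M a) Ψ (pre Λ L c p M a x)) := by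
  refine ContinuousLinearMap.ext fun v ↦ ContinuousLinearMap.ext fun w ↦ ?_
  rw [pullL_apply, Spacetime.deviation_apply, Spacetime.deviation_apply,
    mfderiv_comp_pre_apply Ψ hΨ, mfderiv_comp_pre_apply Ψ hΨ]
  have hb : (Bnew Λ L c p M a).bilin x.1 v w =
      (Bold Λ c M a).bilin (pre Λ L c p M a x).1 ((L : E4 ≃L[ℝ] E4) v) ((L : E4 ≃L[ℝ] E4) w) :=
    bilin_relabel Λ L c p M a x.1 v w
  rw [hb]
  rfl

/-- **Deviation covariance, extended by zero to `E4`**: for every `y : E4`,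
`deviationExtend B' (Ψ ∘ P) y = (L × L)^* (deviationExtend B Ψ (P y))` (off the domain both sides
vanish, since `P` maps the new domain onto the old one). [cite: arXiv210408222, §1] -/
theorem deviationExtend_comp_pre (hΨ : ContMDiff 𝓘(ℝ, E4) (𝓡 4) ∞ Ψ) (y : E4) :
    𝓢.deviationExtend (Bnew Λ L c p M a) (Ψ ∘ pre Λ L c p M a) y =
      pullL L (𝓢.deviationExtend (Bold Λ c M a) Ψ (affP L p y)) := by
  by_cases hy : y ∈ (Bnew Λ L c p M a).domain
  · have hy' : affP L p y ∈ (Bold Λ c M a).domain := (mem_boostedKerrExterior_relabel Λ L c p M a y).1 hy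
    rw [show y = ((⟨y, hy⟩ : (Bnew Λ L c p M a).domain) : E4) from rfl, Spacetime.deviationExtend_coe,
      deviation_comp_pre Ψ hΨ]
    congr 1
    exact (𝓢.deviationExtend_coe (Bold Λ c M a) Ψ ⟨affP L p y, hy'⟩).symm
  · have hy' : affP L p y ∉ (Bold Λ c M a).domain := fun h ↦
      hy ((mem_boostedKerrExterior_relabel Λ L c p M a y).2 h)
    rw [𝓢.deviationExtend_of_not_mem _ _ hy, 𝓢.deviationExtend_of_not_mem _ _ hy', pullL_zero]

/-- Functional form of `deviationExtend_comp_pre`. [folklore] -/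
theorem deviationExtend_comp_pre_eq (hΨ : ContMDiff 𝓘(ℝ, E4) (𝓡 4) ∞ Ψ) :
    𝓢.deviationExtend (Bnew Λ L c p M a) (Ψ ∘ pre Λ L c p M a) =
      (pullL L : (E4 →L[ℝ] E4 →L[ℝ] ℝ) → (E4 →L[ℝ] E4 →L[ℝ] ℝ)) ∘
        (fun z ↦ 𝓢.deviationExtend (Bold Λ c M a) Ψ (z + p)) ∘ ((L : E4 ≃L[ℝ] E4) : E4 → E4) := by
  funext y
  exact deviationExtend_comp_pre Ψ hΨ y

end Chart


/-! ### Jets: `Cᵏ` norms of the relabelled deviation -/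

section Jets

variable {𝓢 : Spacetime.{0} 4} (Ψ : (Bold Λ c M a).domain → 𝓢.carrier)

/-- Pointwise operator-norm bound of the `(L × L)`-pullback: `‖pullL L β‖ ≤ ‖L‖² ‖β‖`. [folklore] -/
theorem norm_pullL_apply_le (β : E4 →L[ℝ] E4 →L[ℝ] ℝ) :
    ‖pullL L β‖ ≤ ‖((L : E4 ≃L[ℝ] E4) : E4 →L[ℝ] E4)‖ ^ 2 * ‖β‖ := by
  refine ContinuousLinearMap.opNorm_le_bound _ (by positivity) fun v ↦ ?_
  refine ContinuousLinearMap.opNorm_le_bound _ (by positivity) fun w ↦ ?_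
  rw [pullL_apply]
  calc ‖β ((L : E4 ≃L[ℝ] E4) v) ((L : E4 ≃L[ℝ] E4) w)‖
      ≤ ‖β ((L : E4 ≃L[ℝ] E4) v)‖ * ‖(L : E4 ≃L[ℝ] E4) w‖ := ContinuousLinearMap.le_opNorm _ _
    _ ≤ (‖β‖ * ‖(L : E4 ≃L[ℝ] E4) v‖) * (‖((L : E4 ≃L[ℝ] E4) : E4 →L[ℝ] E4)‖ * ‖w‖) := by
        gcongr
        · exact ContinuousLinearMap.le_opNorm _ _
        · exact ((L : E4 ≃L[ℝ] E4) : E4 →L[ℝ] E4).le_opNorm w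
    _ ≤ (‖β‖ * (‖((L : E4 ≃L[ℝ] E4) : E4 →L[ℝ] E4)‖ * ‖v‖)) *
          (‖((L : E4 ≃L[ℝ] E4) : E4 →L[ℝ] E4)‖ * ‖w‖) := by
        gcongr
        exact ((L : E4 ≃L[ℝ] E4) : E4 →L[ℝ] E4).le_opNorm v
    _ = ‖((L : E4 ≃L[ℝ] E4) : E4 →L[ℝ] E4)‖ ^ 2 * ‖β‖ * ‖v‖ * ‖w‖ := by ring

/-- Norm bound for the pullback composed on the left of a continuous multilinear map. [folklore] -/
theorem norm_pullL_compContinuousMultilinearMap_le {m : ℕ}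
    (Mm : ContinuousMultilinearMap ℝ (fun _ : Fin m ↦ E4) (E4 →L[ℝ] E4 →L[ℝ] ℝ)) :
    ‖(pullL L : (E4 →L[ℝ] E4 →L[ℝ] ℝ) →L[ℝ]
        (E4 →L[ℝ] E4 →L[ℝ] ℝ)).compContinuousMultilinearMap Mm‖ ≤
      ‖((L : E4 ≃L[ℝ] E4) : E4 →L[ℝ] E4)‖ ^ 2 * ‖Mm‖ := by
  refine ContinuousMultilinearMap.opNorm_le_bound (by positivity) fun v ↦ ?_
  rw [ContinuousLinearMap.compContinuousMultilinearMap_coe, Function.comp_apply,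
    ContinuousLinearEquiv.coe_coe, mul_assoc]
  refine (norm_pullL_apply_le L (Mm v)).trans ?_
  gcongr
  exact Mm.le_opNorm v

/-- The constant of the `Cᵏ` comparison: `‖L‖² · max(1, ‖L‖)ᵏ`. [folklore] -/
def jetConst (k : ℕ) : ℝ≥0∞ :=
  ENNReal.ofReal (‖((L : E4 ≃L[ℝ] E4) : E4 →L[ℝ] E4)‖ ^ 2 *
    max 1 ‖((L : E4 ≃L[ℝ] E4) : E4 →L[ℝ] E4)‖ ^ k)

/-- The constant is finite. [folklore] -/
theorem jetConst_ne_top (k : ℕ) : jetConst L k ≠ ⊤ := ENNReal.ofReal_ne_top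

variable {Λ L c p M a}

/-- **Pointwise jet covariance**: `‖Dᵐ dev'(y)‖ ≤ ‖L‖² · ‖L‖ᵐ · ‖Dᵐ dev(P y)‖` for every `y : E4`
and every order `m` (no differentiability hypothesis: both compositions are by continuous linear
EQUIVALENCES and a translation).  Bartnik 1986, (1.3) (the `Cᵏ` currency). [cite: Bartnik1986, (1.3] -/
theorem norm_iteratedFDeriv_deviationExtend_comp_pre_le (hΨ : ContMDiff 𝓘(ℝ, E4) (𝓡 4) ∞ Ψ)
    (m : ℕ) (y : E4) :
    ‖iteratedFDeriv ℝ m (𝓢.deviationExtend (Bnew Λ L c p M a) (Ψ ∘ pre Λ L c p M a)) y‖ ≤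
      ‖((L : E4 ≃L[ℝ] E4) : E4 →L[ℝ] E4)‖ ^ 2 * ‖((L : E4 ≃L[ℝ] E4) : E4 →L[ℝ] E4)‖ ^ m *
        ‖iteratedFDeriv ℝ m (𝓢.deviationExtend (Bold Λ c M a) Ψ) (affP L p y)‖ := by
  rw [deviationExtend_comp_pre_eq Ψ hΨ]
  set g : E4 → (E4 →L[ℝ] E4 →L[ℝ] ℝ) := fun z ↦ 𝓢.deviationExtend (Bold Λ c M a) Ψ (z + p) with hg
  rw [ContinuousLinearEquiv.iteratedFDeriv_comp_left]
  have h2 : iteratedFDeriv ℝ m (g ∘ ((L : E4 ≃L[ℝ] E4) : E4 → E4)) y =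
      (iteratedFDeriv ℝ m g ((L : E4 ≃L[ℝ] E4) y)).compContinuousLinearMap
        fun _ ↦ ((L : E4 ≃L[ℝ] E4) : E4 →L[ℝ] E4) := by
    have := ContinuousLinearEquiv.iteratedFDerivWithin_comp_right (L : E4 ≃L[ℝ] E4) g
      uniqueDiffOn_univ (Set.mem_univ ((L : E4 ≃L[ℝ] E4) y)) m
    simpa [iteratedFDerivWithin_univ] using this
  have h3 : iteratedFDeriv ℝ m g ((L : E4 ≃L[ℝ] E4) y) =
      iteratedFDeriv ℝ m (𝓢.deviationExtend (Bold Λ c M a) Ψ) ((L : E4 ≃L[ℝ] E4) y + p) :=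
    iteratedFDeriv_comp_add_right m p _
  rw [h2, h3]
  refine (norm_pullL_compContinuousMultilinearMap_le L _).trans ?_
  rw [mul_assoc]
  gcongr
  refine (ContinuousMultilinearMap.norm_compContinuousLinearMap_le _ _).trans ?_
  rw [Finset.prod_const, Finset.card_univ, Fintype.card_fin, mul_comm]
  rfl

/-- **`Cᵏ` sup-norm covariance**: over any set `S ⊆ E4`,
`supCkENorm S k dev' ≤ ‖L‖² max(1,‖L‖)ᵏ · supCkENorm (P '' S) k dev` (Bartnik 1986, (1.3)).
[cite: Bartnik1986, (1.3] -/
theorem supCkENorm_deviationExtend_comp_pre_le (hΨ : ContMDiff 𝓘(ℝ, E4) (𝓡 4) ∞ Ψ)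
    (S : Set E4) (k : ℕ) :
    supCkENorm S k (𝓢.deviationExtend (Bnew Λ L c p M a) (Ψ ∘ pre Λ L c p M a)) ≤
      jetConst L k * supCkENorm (affP L p '' S) k (𝓢.deviationExtend (Bold Λ c M a) Ψ) := by
  refine iSup₂_le fun m hm ↦ iSup₂_le fun y hy ↦ ?_
  have hpt := norm_iteratedFDeriv_deviationExtend_comp_pre_le (L := L) (p := p) Ψ hΨ m y
  set nL := ‖((L : E4 ≃L[ℝ] E4) : E4 →L[ℝ] E4)‖ with hnL
  have hC : nL ^ 2 * nL ^ m ≤ nL ^ 2 * max 1 nL ^ k := by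
    have h1 : nL ^ m ≤ max 1 nL ^ m := pow_le_pow_left₀ (norm_nonneg _) (le_max_right _ _) m
    have h2 : max 1 nL ^ m ≤ max 1 nL ^ k := pow_le_pow_right₀ (le_max_left _ _) hm
    exact mul_le_mul_of_nonneg_left (h1.trans h2) (by positivity)
  have hsup : ‖iteratedFDeriv ℝ m (𝓢.deviationExtend (Bold Λ c M a) Ψ) (affP L p y)‖ₑ ≤
      supCkENorm (affP L p '' S) k (𝓢.deviationExtend (Bold Λ c M a) Ψ) :=
    enorm_iteratedFDeriv_le_supCkENorm hm (Set.mem_image_of_mem _ hy) _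
  calc ‖iteratedFDeriv ℝ m (𝓢.deviationExtend (Bnew Λ L c p M a) (Ψ ∘ pre Λ L c p M a)) y‖ₑ
      = ENNReal.ofReal ‖iteratedFDeriv ℝ m
          (𝓢.deviationExtend (Bnew Λ L c p M a) (Ψ ∘ pre Λ L c p M a)) y‖ :=
        (ofReal_norm _).symm
    _ ≤ ENNReal.ofReal ((nL ^ 2 * max 1 nL ^ k) *
          ‖iteratedFDeriv ℝ m (𝓢.deviationExtend (Bold Λ c M a) Ψ) (affP L p y)‖) := by
        refine ENNReal.ofReal_le_ofReal (hpt.trans ?_)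
        exact mul_le_mul_of_nonneg_right hC (norm_nonneg _)
    _ = jetConst L k *
          ‖iteratedFDeriv ℝ m (𝓢.deviationExtend (Bold Λ c M a) Ψ) (affP L p y)‖ₑ := by
        rw [ENNReal.ofReal_mul (by positivity), ofReal_norm]
        rfl
    _ ≤ _ := mul_le_mul' le_rfl hsup

end Jets

/-! ### Consequences: near-zone convergence and `C⁰` honesty transfer to the relabelled chart -/

section Transfer

variable {𝓢 : Spacetime.{0} 4} (Ψ : (Bold Λ c M a).domain → 𝓢.carrier)

variable {Λ L c p M a}

/-- The model map sends the relabelled truncated slab `{t' = τ, r' ≤ R}` into the old one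
(DHRT arXiv:2104.08222, §1). [cite: arXiv210408222, §1] -/
theorem affP_image_truncTimeSlab_subset (R τ : ℝ) :
    affP L p '' (Subtype.val '' (Bnew Λ L c p M a).truncTimeSlab R τ) ⊆
      Subtype.val '' (Bold Λ c M a).truncTimeSlab R τ := by
  rintro _ ⟨y, ⟨x, hx, rfl⟩, rfl⟩
  refine ⟨pre Λ L c p M a x, ?_, rfl⟩
  rw [ModelBackground.mem_truncTimeSlab] at hx ⊢
  change (Bold Λ c M a).time (affP L p x.1) = τ ∧ (Bold Λ c M a).radius (affP L p x.1) ≤ R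
  rw [← time_relabel, ← radius_relabel]
  exact hx

/-- **Truncated `Cᵏ` deviation of the relabelled chart is bounded by a fixed multiple of the old
one** (DHRT arXiv:2104.08222, §1). [cite: arXiv210408222, §1] -/
theorem truncDeviationCk_comp_pre_le (hΨ : ContMDiff 𝓘(ℝ, E4) (𝓡 4) ∞ Ψ) (k : ℕ) (R τ : ℝ) :
    𝓢.truncDeviationCk (Bnew Λ L c p M a) (Ψ ∘ pre Λ L c p M a) k R τ ≤
      jetConst L k * 𝓢.truncDeviationCk (Bold Λ c M a) Ψ k R τ :=
  (supCkENorm_deviationExtend_comp_pre_le Ψ hΨ _ k).trans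
    (mul_le_mul' le_rfl (supCkENorm_mono (affP_image_truncTimeSlab_subset R τ) _ _))

/-- **Near-zone convergence is relabelling-covariant**: if `Ψ^* g → g_{(Λ,c)}` in `Cᵏ` on every
truncated slab, then `(Ψ ∘ P)^* g → g_{(L⁻¹Λ, L⁻¹(c−p))}` in `Cᵏ` on every truncated slab — the
structure field `FinalStateDecomposition.tendsto_truncDeviationCk` is relabelling-covariant
(DHRT arXiv:2104.08222, §1). [cite: arXiv210408222, §1] -/
theorem tendsto_truncDeviationCk_comp_pre (hΨ : ContMDiff 𝓘(ℝ, E4) (𝓡 4) ∞ Ψ) (k : ℕ) (R : ℝ)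
    (h : Tendsto (fun τ ↦ 𝓢.truncDeviationCk (Bold Λ c M a) Ψ k R τ) atTop (𝓝 0)) :
    Tendsto (fun τ ↦ 𝓢.truncDeviationCk (Bnew Λ L c p M a) (Ψ ∘ pre Λ L c p M a) k R τ)
      atTop (𝓝 0) := by
  have hlim : Tendsto (fun τ ↦ jetConst L k * 𝓢.truncDeviationCk (Bold Λ c M a) Ψ k R τ)
      atTop (𝓝 0) := by
    have := ENNReal.Tendsto.const_mul h (Or.inr (jetConst_ne_top L k))
    simpa using this
  exact tendsto_of_tendsto_of_tendsto_of_le_of_le tendsto_const_nhds hlim (fun _ ↦ zero_le)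
    fun τ ↦ truncDeviationCk_comp_pre_le Ψ hΨ k R τ

/-- **`C⁰` sup bounds over corresponding sets transfer with the factor `‖L‖²`**: for any set
`S ⊆ E4` (e.g. a late Voronoi cell, whose relabelled version is the `P`-preimage of the old one),
`sup_S ‖dev'‖ ≤ ‖L‖² · sup_{P(S)} ‖dev‖` — `Hf`(3)-type thresholds transfer with slack `‖L‖²`. [folklore] -/
theorem supCkENorm_zero_comp_pre_le (hΨ : ContMDiff 𝓘(ℝ, E4) (𝓡 4) ∞ Ψ) (S : Set E4) :
    supCkENorm S 0 (𝓢.deviationExtend (Bnew Λ L c p M a) (Ψ ∘ pre Λ L c p M a)) ≤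
      ENNReal.ofReal (‖((L : E4 ≃L[ℝ] E4) : E4 →L[ℝ] E4)‖ ^ 2) *
        supCkENorm (affP L p '' S) 0 (𝓢.deviationExtend (Bold Λ c M a) Ψ) := by
  refine (supCkENorm_deviationExtend_comp_pre_le Ψ hΨ S 0).trans (mul_le_mul' (le_of_eq ?_) le_rfl)
  simp [jetConst]

end Transfer

end Summit.FinalStateConjecture.FinalStateConjecture.Theorems.GapDecaySuffices.Negative.Relabel

end
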